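import Summits.Parity.GeneralizedHardyLittlewood.Theses.LiouvilleShiftedTables

/-!
# `MAvg`: sandwich between its dilation slices and the unweighted `ℓ¹`-form

Route `LiouvilleShiftedTables`, item `MAvg` (stmt-Parity-14273, = stmt-Parity-0613 by signature):
`∀ h ≥ 1, ∃ ε > 0, ∑_{m ≤ x^ε} log m · |S_m(x)| = o(x)` with the dilation slices
`S_m(x) := ∑_{d ≤ x/m} μ(d) Λ(d m + h)` (the Möbius function of the cofactor `(p - h)/m` summed
along the primes `p ≡ h (mod m)`, `p ≤ x + h`, with weight `log p`).

Two elementary book-keeping facts that locate the item (supports, not a proof):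

* `isLittleO_moebius_dilated_slice_of_MAvg` — NECESSITY of every slice: all summands are
  non-negative and `m ≤ x^ε` eventually, so `MAvg` at the shift `h` forces `S_m(x) = o(x)` for
  EVERY fixed dilation `m ≥ 2` — a fixed-shift, fixed-modulus "Möbius ⟂ shifted primes"
  statement with no average left (the shape Harman 2007 §14.2, p. 336, lists as Type-II
  information "we do not have at all": `∑_{d ∼ D} |∑_{dn = p+2} μ(n)|`; dilated form of the
  folklore conjecture `Literature.NumberTheory.Sieve.MoebiusShiftedPrimesConjecture`).
  Contrapositively, refuting one slice refutes `MAvg`.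
* `MAvg_of_isLittleO_log_mul_sum_abs_slices` — SUFFICIENCY of the unweighted `ℓ¹` form with
  one logarithm to spare: since `log m ≤ ε log x` on the range, `MAvg` follows from
  `log x · ∑_{m ≤ x^ε} |S_m(x)| = o(x)`, i.e. from a saving of `(log x)^{1+}` per unit in Harman's
  display summed over all dilations `m ≤ x^ε` (the first step of the route's `SieveToMAvg` plan).
-/

open Filter Asymptotics Finset

namespace Summit.Parity.GeneralizedHardyLittlewood.Theorems

/-- Each dilation slice of `MAvg` is `o(x)`: if `MAvg` holds then for every shift `h ≥ 1` and every
fixed dilation `m ≥ 2`, `∑_{d ≤ x/m} μ(d) Λ(d m + h) = o(x)` as `x → ∞` (a single non-negative term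
`log m · |S_m(x)|` of the `MAvg` sum is at most the whole sum once `m ≤ ⌊x^ε⌋`, and `log m > 0`). -/
theorem isLittleO_moebius_dilated_slice_of_MAvg
    (hM : Summit.Parity.GeneralizedHardyLittlewood.Theses.LiouvilleShiftedTables.MAvg)
    {h : ℕ} (hh : 1 ≤ h) {m : ℕ} (hm : 2 ≤ m) :
    (fun x : ℝ => ∑ d ∈ Finset.Icc 1 ⌊x / m⌋₊,
        (ArithmeticFunction.moebius d : ℝ) * ArithmeticFunction.vonMangoldt (d * m + h))
      =o[atTop] fun x : ℝ => x := by
  obtain ⟨ε, hε, hO⟩ := hM h hh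
  have hlog : 0 < Real.log (m : ℝ) := Real.log_pos (by exact_mod_cast hm)
  refine IsBigO.trans_isLittleO (IsBigO.of_bound (Real.log (m : ℝ))⁻¹ ?_) hO
  filter_upwards [(tendsto_rpow_atTop hε).eventually_ge_atTop (m : ℝ)] with x hx
  have hmem : m ∈ Finset.Icc 1 ⌊x ^ ε⌋₊ := Finset.mem_Icc.mpr ⟨by omega, Nat.le_floor hx⟩
  have hle : Real.log (m : ℝ) * |∑ d ∈ Finset.Icc 1 ⌊x / m⌋₊,
        (ArithmeticFunction.moebius d : ℝ) * ArithmeticFunction.vonMangoldt (d * m + h)|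
      ≤ ∑ m' ∈ Finset.Icc 1 ⌊x ^ ε⌋₊, Real.log (m' : ℝ) * |∑ d ∈ Finset.Icc 1 ⌊x / m'⌋₊,
        (ArithmeticFunction.moebius d : ℝ) * ArithmeticFunction.vonMangoldt (d * m' + h)| :=
    Finset.single_le_sum (f := fun m' : ℕ => Real.log (m' : ℝ) * |∑ d ∈ Finset.Icc 1 ⌊x / m'⌋₊,
        (ArithmeticFunction.moebius d : ℝ) * ArithmeticFunction.vonMangoldt (d * m' + h)|)
      (fun i _ => mul_nonneg (Real.log_natCast_nonneg i) (abs_nonneg _)) hmem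
  rw [Real.norm_eq_abs, Real.norm_eq_abs]
  calc |∑ d ∈ Finset.Icc 1 ⌊x / m⌋₊,
          (ArithmeticFunction.moebius d : ℝ) * ArithmeticFunction.vonMangoldt (d * m + h)|
        = (Real.log (m : ℝ))⁻¹ * (Real.log (m : ℝ) * |∑ d ∈ Finset.Icc 1 ⌊x / m⌋₊,
          (ArithmeticFunction.moebius d : ℝ) * ArithmeticFunction.vonMangoldt (d * m + h)|) := by
          rw [inv_mul_cancel_left₀ hlog.ne']
    _ ≤ (Real.log (m : ℝ))⁻¹ * ∑ m' ∈ Finset.Icc 1 ⌊x ^ ε⌋₊, Real.log (m' : ℝ) *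
          |∑ d ∈ Finset.Icc 1 ⌊x / m'⌋₊,
            (ArithmeticFunction.moebius d : ℝ) * ArithmeticFunction.vonMangoldt (d * m' + h)| :=
          mul_le_mul_of_nonneg_left hle (inv_nonneg.mpr hlog.le)
    _ ≤ (Real.log (m : ℝ))⁻¹ * |∑ m' ∈ Finset.Icc 1 ⌊x ^ ε⌋₊, (Real.log (m' : ℝ) *
          |∑ d ∈ Finset.Icc 1 ⌊x / m'⌋₊,
            (ArithmeticFunction.moebius d : ℝ) * ArithmeticFunction.vonMangoldt (d * m' + h)|)| :=
          mul_le_mul_of_nonneg_left (le_abs_self _) (inv_nonneg.mpr hlog.le)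

/-- `MAvg` follows from the unweighted `ℓ¹`-form with one logarithm to spare: if for every shift
`h ≥ 1` there is `ε > 0` with `log x · ∑_{m ≤ x^ε} |∑_{d ≤ x/m} μ(d) Λ(d m + h)| = o(x)`, then `MAvg`
holds (with the same `ε`), because `log m ≤ log (x^ε) = ε log x` for `1 ≤ m ≤ ⌊x^ε⌋` and `x ≥ 1`. -/
theorem MAvg_of_isLittleO_log_mul_sum_abs_slices
    (H : ∀ h : ℕ, 1 ≤ h → ∃ ε : ℝ, 0 < ε ∧
      (fun x : ℝ => Real.log x * ∑ m ∈ Finset.Icc 1 ⌊x ^ ε⌋₊,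
          |∑ d ∈ Finset.Icc 1 ⌊x / m⌋₊,
            (ArithmeticFunction.moebius d : ℝ) * ArithmeticFunction.vonMangoldt (d * m + h)|)
        =o[atTop] fun x : ℝ => x) :
    Summit.Parity.GeneralizedHardyLittlewood.Theses.LiouvilleShiftedTables.MAvg := by
  intro h hh
  obtain ⟨ε, hε, hO⟩ := H h hh
  refine ⟨ε, hε, IsBigO.trans_isLittleO (IsBigO.of_bound ε ?_) hO⟩
  filter_upwards [eventually_ge_atTop (1 : ℝ)] with x hx
  have hx0 : 0 < x := by linarith
  have hterm : ∀ m ∈ Finset.Icc 1 ⌊x ^ ε⌋₊,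
      Real.log (m : ℝ) * |∑ d ∈ Finset.Icc 1 ⌊x / m⌋₊,
          (ArithmeticFunction.moebius d : ℝ) * ArithmeticFunction.vonMangoldt (d * m + h)|
        ≤ ε * Real.log x * |∑ d ∈ Finset.Icc 1 ⌊x / m⌋₊,
          (ArithmeticFunction.moebius d : ℝ) * ArithmeticFunction.vonMangoldt (d * m + h)| := by
    intro m hm
    obtain ⟨hm1, hm2⟩ := Finset.mem_Icc.mp hm
    have hmpos : (0 : ℝ) < m := by exact_mod_cast hm1
    have hmle : (m : ℝ) ≤ x ^ ε := (Nat.le_floor_iff (Real.rpow_nonneg hx0.le ε)).mp hm2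
    have hlogle : Real.log (m : ℝ) ≤ ε * Real.log x :=
      calc Real.log (m : ℝ) ≤ Real.log (x ^ ε) := Real.log_le_log hmpos hmle
        _ = ε * Real.log x := Real.log_rpow hx0 ε
    exact mul_le_mul_of_nonneg_right hlogle (abs_nonneg _)
  have hsum : ∑ m ∈ Finset.Icc 1 ⌊x ^ ε⌋₊, Real.log (m : ℝ) * |∑ d ∈ Finset.Icc 1 ⌊x / m⌋₊,
          (ArithmeticFunction.moebius d : ℝ) * ArithmeticFunction.vonMangoldt (d * m + h)|
        ≤ ε * (Real.log x * ∑ m ∈ Finset.Icc 1 ⌊x ^ ε⌋₊, |∑ d ∈ Finset.Icc 1 ⌊x / m⌋₊,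
          (ArithmeticFunction.moebius d : ℝ) * ArithmeticFunction.vonMangoldt (d * m + h)|) :=
    calc ∑ m ∈ Finset.Icc 1 ⌊x ^ ε⌋₊, Real.log (m : ℝ) * |∑ d ∈ Finset.Icc 1 ⌊x / m⌋₊,
            (ArithmeticFunction.moebius d : ℝ) * ArithmeticFunction.vonMangoldt (d * m + h)|
          ≤ ∑ m ∈ Finset.Icc 1 ⌊x ^ ε⌋₊, ε * Real.log x * |∑ d ∈ Finset.Icc 1 ⌊x / m⌋₊,
            (ArithmeticFunction.moebius d : ℝ) * ArithmeticFunction.vonMangoldt (d * m + h)| :=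
            Finset.sum_le_sum hterm
      _ = ε * (Real.log x * ∑ m ∈ Finset.Icc 1 ⌊x ^ ε⌋₊, |∑ d ∈ Finset.Icc 1 ⌊x / m⌋₊,
            (ArithmeticFunction.moebius d : ℝ) * ArithmeticFunction.vonMangoldt (d * m + h)|) := by
            rw [Finset.mul_sum, Finset.mul_sum]
            exact Finset.sum_congr rfl (fun _ _ => by ring)
  have hnonneg : 0 ≤ ∑ m ∈ Finset.Icc 1 ⌊x ^ ε⌋₊, Real.log (m : ℝ) *
      |∑ d ∈ Finset.Icc 1 ⌊x / m⌋₊,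
        (ArithmeticFunction.moebius d : ℝ) * ArithmeticFunction.vonMangoldt (d * m + h)| :=
    Finset.sum_nonneg (fun m _ => mul_nonneg (Real.log_natCast_nonneg m) (abs_nonneg _))
  rw [Real.norm_eq_abs, Real.norm_eq_abs, abs_of_nonneg hnonneg]
  exact hsum.trans (mul_le_mul_of_nonneg_left (le_abs_self _) hε.le)

end Summit.Parity.GeneralizedHardyLittlewood.Theorems
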